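import Literature.Topology.FourManifolds.NormalRetraction
import Literature.Topology.FourManifolds.InteriorManifold
import Literature.Geometry.Manifold.ModelChange
import Mathlib.Geometry.Manifold.WhitneyEmbedding
import Mathlib.Geometry.Manifold.SmoothApprox
import Mathlib.Analysis.InnerProductSpace.EuclideanDist
import Mathlib.Topology.MetricSpace.Thickening
import Mathlib.Topology.Homotopy.Basic
import HarnessLib

/-!
# Whitney approximation: a continuous map into a compact manifold is homotopic to a smooth map
(topic `Geometry/Manifold`)

The topological half of every existence theorem "each homotopy class of maps `M → N` contains a
map solving a PDE" (first consumer: the Eells–Sampson theorem,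
`Literature.Geometry.Riemannian.eellsSampson_existence`, `Geometry/Riemannian/EellsSampson.lean`,
whose statement quantifies over *continuous* maps `f : C(M, N)` between manifolds with arbitrary
models with corners): **every continuous map from a manifold `M` into a compact manifold `N`
without boundary is homotopic to a `C^∞` map** (Lee, *Introduction to Smooth Manifolds*, 2nd ed.,
Thm. 6.26, Whitney approximation for maps into manifolds: "Suppose `F : M → N` is a continuous
map. Then `F` is homotopic to a smooth map"; Hirsch, *Differential Topology*, Ch. 2 §2 Thm. 2.6
with Ch. 4 §5; Bott–Tu, Prop. 17.8). Here `N` is compact (the case of all consumers), which is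
what the tree's tubular-neighbourhood retraction needs.

* `Literature.Geometry.Manifold.exists_contMDiff_homotopic_of_chartedSpace_euclideanSpace` — the
  case of a target `V` charted on `ℝⁿ = EuclideanSpace ℝ (Fin n)` (model `𝓡 n`): embed
  `V ⊆ ℝᴺ` (Mathlib's Whitney embedding `exists_embedding_euclidean_of_compact`), take a smooth
  normal retraction `r : T → V` of an open tube `T ⊇ V`
  (`Literature.Topology.FourManifolds.exists_normalRetraction`, `NormalRetraction.lean`), approximate
  `e ∘ f` uniformly within the tube margin by a smooth `g : M → ℝᴺ` (Mathlib's
  `Continuous.exists_contMDiff_approx`, smooth partitions of unity), and retract the straight-line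
  homotopy: `H(t, x) = r ((1 - t) e (f x) + t g x)`, from `r ∘ e ∘ f = f` to the smooth map
  `r ∘ g` (Lee's proof of Thm. 6.26 verbatim, with `ℝᴺ ⊇ T → V` the tubular retraction of
  Prop. 6.25).
* `Literature.Geometry.Manifold.exists_contMDiff_homotopic` — the general case: `N` a compact
  Hausdorff `C^∞` manifold over ANY model with corners `IN : ModelWithCorners ℝ EN HN` on a
  finite-dimensional `EN`, without boundary in the sense `BoundarylessManifold IN N`. Reduction
  to the first case without touching `N`: `N` is canonically diffeomorphic (by the identity on
  points) to its interior re-modelled on `EN`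
  (`Literature.Topology.FourManifolds.InteriorManifold IN N`, `InteriorManifold.lean`: charts =
  extended charts, all points being interior), which in turn is diffeomorphic (identity on
  points) to its recharting on `ℝ^{dim EN}` along `toEuclidean : EN ≃L[ℝ] ℝ^{dim EN}`
  (`Literature.Geometry.Manifold.Rechart`, `ModelChange.lean`); homotopies and smooth maps are
  transported along this homeomorphism/diffeomorphism.

The source `M` is any σ-compact Hausdorff `C^∞` manifold over a model with corners on a
finite-dimensional space (boundary and corners allowed). Everything here is proved; no
definitions, no named facts.

## References

* J. M. Lee, *Introduction to Smooth Manifolds*, 2nd ed., GTM 218, Springer (2013), Thm. 6.26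
  (Whitney approximation for functions into manifolds), Prop. 6.25 (tubular neighbourhood
  retraction), Thm. 6.15 (Whitney embedding, compact case). [LeeSmoothManifolds2013]
* M. W. Hirsch, *Differential Topology*, GTM 33, Springer (1976), Ch. 2 §2 Thm. 2.6, Ch. 4 §5.
  [HirschDT1976]
-/

open scoped Manifold ContDiff Topology
open Function Set Filter

noncomputable section

namespace Literature.Geometry.Manifold

open Literature.Topology.FourManifolds

/-! ### Targets charted on `ℝⁿ` -/

/-- **Whitney approximation, target charted on `ℝⁿ`.** Let `M` be a σ-compact Hausdorff `C^∞`
manifold (model with corners `IM` on a finite-dimensional space) and `V` a compact Hausdorff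
`C^∞` manifold charted on `EuclideanSpace ℝ (Fin n)` (model `𝓡 n`). Then every continuous map
`f : C(M, V)` is homotopic to a `C^∞` map: with a Whitney embedding `e : V → ℝᴺ`, a smooth normal
retraction `r` of an open tube `T ⊇ e(V)` and a smooth `g : M → ℝᴺ` uniformly close to `e ∘ f`
within the tube margin, `H(t, x) = r ((1 - t) e (f x) + t g x)` is a homotopy from `f` to the
smooth map `r ∘ g`. [cite: LeeSmoothManifolds2013, Thm. 6.26] -/
theorem exists_contMDiff_homotopic_of_chartedSpace_euclideanSpace
    {EM HM : Type*} [NormedAddCommGroup EM] [NormedSpace ℝ EM] [FiniteDimensional ℝ EM]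
    [TopologicalSpace HM] {IM : ModelWithCorners ℝ EM HM} {M : Type*} [TopologicalSpace M]
    [ChartedSpace HM M] [IsManifold IM ∞ M] [SigmaCompactSpace M] [T2Space M]
    {n : ℕ} {V : Type*} [TopologicalSpace V] [ChartedSpace (EuclideanSpace ℝ (Fin n)) V]
    [IsManifold (𝓡 n) ∞ V] [CompactSpace V] [T2Space V] (f : C(M, V)) :
    ∃ φ : C(M, V), ContMDiff IM (𝓡 n) ∞ φ ∧ f.Homotopic φ := by
  rcases isEmpty_or_nonempty M with hM | hM
  · exact ⟨f, fun x => (IsEmpty.false x).elim, ContinuousMap.Homotopic.refl f⟩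
  haveI : Nonempty V := ⟨f (Classical.arbitrary M)⟩
  -- ### Whitney embedding of `V` and a smooth normal retraction
  obtain ⟨N, e, he, hemb, hinj⟩ := exists_embedding_euclidean_of_compact (I := 𝓡 n) (M := V)
  obtain ⟨ε, hε, hTopen, hr, hre⟩ := exists_normalRetraction (I := 𝓡 n) he hemb.injective hinj
  set T := normalTube (𝓡 n) e ε with hTdef
  set r := normalRetraction (𝓡 n) e ε with hrdef
  have hreT : ∀ y : V, e y ∈ T ∧ r (e y) = y := fun y => by
    simpa [hTdef, hrdef] using hre y 0 (Submodule.zero_mem _) (by simpa using hε)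
  -- ### the map read in `ℝᴺ`, the tube margin, the smooth approximation
  set F : M → EuclideanSpace ℝ (Fin N) := fun p => e (f p) with hF
  have hFc : Continuous F := he.continuous.comp f.continuous
  obtain ⟨δ, hδ, hδT⟩ := (isCompact_range he.continuous).exists_cthickening_subset_open hTopen
    (range_subset_iff.2 fun y => (hreT y).1)
  obtain ⟨g, hgF, -⟩ := hFc.exists_contMDiff_approx IM ⊤ continuous_const (fun _ => hδ)
  -- ### the segments from `F p` to `g p` stay in the tube
  have hseg : ∀ s : ℝ, s ∈ Icc (0 : ℝ) 1 → ∀ p : M, F p + s • (g p - F p) ∈ T := by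
    intro s hs p
    apply hδT
    refine Metric.mem_cthickening_of_dist_le _ (F p) _ _ ⟨f p, rfl⟩ ?_
    rw [dist_eq_norm, add_sub_cancel_left, norm_smul, Real.norm_eq_abs, abs_of_nonneg hs.1]
    calc s * ‖g p - F p‖ ≤ 1 * ‖g p - F p‖ := by gcongr; exact hs.2
      _ = dist (g p) (F p) := by rw [one_mul, dist_eq_norm]
      _ ≤ δ := (hgF p).le
  have hgT : ∀ p, g p ∈ T := fun p => by
    simpa using hseg 1 ⟨zero_le_one, le_rfl⟩ p
  have hHc : Continuous fun q : unitInterval × M => r (F q.2 + (q.1 : ℝ) • (g q.2 - F q.2)) := by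
    refine hr.continuousOn.comp_continuous ?_ fun q => hseg q.1 ⟨q.1.2.1, q.1.2.2⟩ q.2
    fun_prop
  -- ### the smooth map `r ∘ g` and the retracted straight-line homotopy
  refine ⟨⟨fun p => r (g p), hr.continuousOn.comp_continuous g.contMDiff.continuous hgT⟩,
    hr.comp_contMDiff g.contMDiff hgT, ⟨?_⟩⟩
  exact
    { toFun := fun q : unitInterval × M => r (F q.2 + (q.1 : ℝ) • (g q.2 - F q.2))
      continuous_toFun := hHc
      map_zero_left := fun p => by
        change r (F p + ((0 : unitInterval) : ℝ) • (g p - F p)) = f p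
        rw [Set.Icc.coe_zero, zero_smul, add_zero]
        exact (hreT (f p)).2
      map_one_left := fun p => by
        change r (F p + ((1 : unitInterval) : ℝ) • (g p - F p)) = r (g p)
        rw [Set.Icc.coe_one, one_smul, add_sub_cancel] }

/-! ### Targets with an arbitrary model with corners, without boundary -/

/-- **Whitney approximation for maps into a compact manifold without boundary** (Lee 2013,
Thm. 6.26; Hirsch 1976, Ch. 2 Thm. 2.6): let `M` be a σ-compact Hausdorff `C^∞` manifold over a
model with corners `IM` on a finite-dimensional real space, and `N` a compact Hausdorff `C^∞`
manifold over any model with corners `IN : ModelWithCorners ℝ EN HN` on a finite-dimensional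
`EN`, without boundary (`BoundarylessManifold IN N`). Then every continuous `f : C(M, N)` is
homotopic to a `C^∞` map `φ : M → N`. (Reduction to the `ℝⁿ`-charted case along the identity
diffeomorphisms `N ≅ InteriorManifold IN N ≅ Rechart toEuclidean (InteriorManifold IN N)`.)
[cite: LeeSmoothManifolds2013, Thm. 6.26] -/
theorem exists_contMDiff_homotopic
    {EM HM : Type*} [NormedAddCommGroup EM] [NormedSpace ℝ EM] [FiniteDimensional ℝ EM]
    [TopologicalSpace HM] {IM : ModelWithCorners ℝ EM HM} {M : Type*} [TopologicalSpace M]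
    [ChartedSpace HM M] [IsManifold IM ∞ M] [SigmaCompactSpace M] [T2Space M]
    {EN HN : Type*} [NormedAddCommGroup EN] [NormedSpace ℝ EN] [FiniteDimensional ℝ EN]
    [TopologicalSpace HN] {IN : ModelWithCorners ℝ EN HN} {N : Type*} [TopologicalSpace N]
    [ChartedSpace HN N] [IsManifold IN ∞ N] [BoundarylessManifold IN N] [CompactSpace N]
    [T2Space N] (f : C(M, N)) :
    ∃ φ : C(M, N), ContMDiff IM IN ∞ φ ∧ f.Homotopic φ := by
  -- ### `N` is its own interior, a manifold charted on `EN`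
  let Φ : N ≃ₜ InteriorManifold IN N :=
    { toFun := fun x => ⟨x, BoundarylessManifold.isInteriorPoint (I := IN)⟩
      invFun := InteriorManifold.val
      left_inv := fun _ => rfl
      right_inv := fun _ => rfl
      continuous_toFun := InteriorManifold.continuous_iff_comp_val.2 continuous_id
      continuous_invFun := InteriorManifold.continuous_val }
  haveI : CompactSpace (InteriorManifold IN N) := Φ.compactSpace
  -- ### recharting the interior on `ℝ^{dim EN}`
  let L : EN ≃L[ℝ] EuclideanSpace ℝ (Fin (Module.finrank ℝ EN)) := toEuclidean
  have hIf : ∀ x : EN, L.toHomeomorph x = L (𝓘(ℝ, EN) x) := fun x => rfl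
  have hL : ContMDiff 𝓘(ℝ, EN) 𝓘(ℝ, EuclideanSpace ℝ (Fin (Module.finrank ℝ EN))) ∞
      L.toHomeomorph :=
    Rechart.contMDiff_of_apply_eq_linear (I := 𝓘(ℝ, EN)) L.toHomeomorph L hIf
  have hL' : ContMDiff 𝓘(ℝ, EuclideanSpace ℝ (Fin (Module.finrank ℝ EN))) 𝓘(ℝ, EN) ∞
      L.toHomeomorph.symm :=
    Rechart.contMDiff_symm_of_apply_eq_linear (I := 𝓘(ℝ, EN)) L.toHomeomorph L hIf
  haveI : IsManifold 𝓘(ℝ, EuclideanSpace ℝ (Fin (Module.finrank ℝ EN))) ∞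
      (Rechart L.toHomeomorph (InteriorManifold IN N)) :=
    Rechart.isManifold L.toHomeomorph (InteriorManifold IN N) hL hL'
  -- ### the identity homeomorphism `Θ : N ≃ₜ V` onto the `ℝⁿ`-charted copy `V`
  let Θ : N ≃ₜ Rechart L.toHomeomorph (InteriorManifold IN N) :=
    Φ.trans (Rechart.outHomeomorph L.toHomeomorph (InteriorManifold IN N)).symm
  have hΘsymm : ContMDiff 𝓘(ℝ, EuclideanSpace ℝ (Fin (Module.finrank ℝ EN))) IN ∞
      (Θ.symm : Rechart L.toHomeomorph (InteriorManifold IN N) → N) :=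
    (InteriorManifold.contMDiff_val (I := IN) (M := N)).comp
      (Rechart.contMDiff_out L.toHomeomorph (InteriorManifold IN N) hL hL')
  -- ### Whitney approximation in `V`, transported back along `Θ`
  obtain ⟨ψ, hψ, hhom⟩ := exists_contMDiff_homotopic_of_chartedSpace_euclideanSpace (IM := IM)
    (n := Module.finrank ℝ EN)
    ((Θ : C(N, Rechart L.toHomeomorph (InteriorManifold IN N))).comp f)
  refine ⟨(Θ.symm : C(Rechart L.toHomeomorph (InteriorManifold IN N), N)).comp ψ,
    hΘsymm.comp hψ, ?_⟩
  have hcomp := (ContinuousMap.Homotopic.refl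
    (Θ.symm : C(Rechart L.toHomeomorph (InteriorManifold IN N), N))).comp hhom
  rwa [← ContinuousMap.comp_assoc, Homeomorph.symm_comp_toContinuousMap,
    ContinuousMap.id_comp] at hcomp

end Literature.Geometry.Manifold

end
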